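import Summits.AtomisticToContinuum.BoseEinsteinCondensation.Theorems.BECInsertionCorrectorCorrectorClosureNearMinimiserRigidityJensen
import Literature.MathematicalPhysics.QuantumManyBody.PeriodicBoseGasTagged
import Literature.MathematicalPhysics.QuantumManyBody.SwapPurity
import Literature.MathematicalPhysics.QuantumManyBody.DyadicCoherentFractionRefinement
import HarnessLib

/-!
# Near-minimiser rigidity on the torus, II: rigidity of near-minimisers and the insertion overlap
# (support for stub `stub_nearMinimiserRigidity` of line `healing-scale-kac-insertion`,
# crux `BECInsertionCorrector.CorrectorClosure`, item stmt-AtomisticToContinuum-12058)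

Part 2 of 3.

* `rigidity_of_nearMinimiser` — **rigidity at fixed `N`**: for a continuous strictly positive
  Feynman–Kac ground state `Ψ₀` of the `M`-body torus Hamiltonian (bounded `v^per`) and `η > 0` there is
  `δ > 0` (`η` times the relative spectral gap of `e^{-H}`) such that every periodic trial state `Ψ` with
  `𝓔^per[Ψ] ≤ E₀ + δ` satisfies `1 - η ≤ |α|²`, `‖Ψ - αΨ₀‖²_cell ≤ η` for some `|α| ≤ 1` (in fact
  `α = ⟨Ψ₀, Ψ⟩_cell`): Jensen's bound of Part I against the two-level bound.
* The insertion overlap `ov(F, G) = ∫_{cell^N} conj F(X) ∫_cell G(x, X) dx dX` of an `N`-body and an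
  `(N+1)`-body function: Cauchy–Schwarz `L⁻³|ov(F,G)|² ≤ ‖F‖²‖G‖²` (`overlap_sq_le`, `norm_overlap_le`),
  integrability and bilinearity `ov(F,G) - ov(F',G') = ov(F-F',G) + ov(F',G-G')` (`overlap_sub_overlap`).

References: Reed–Simon IV Thm XIII.44 [ReedSimonIV1978]; Fournais (2021) (1.3)–(1.5) [Fournais2020].
-/

noncomputable section

open MeasureTheory Filter Matrix
open scoped ENNReal NNReal ComplexConjugate InnerProductSpace Topology

namespace Summit.AtomisticToContinuum.BoseEinsteinCondensation.Theorems.CorrectorClosure.HealingScaleKacInsertion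

open Literature.MathematicalPhysics.QuantumManyBody.BoseGas

variable {M N : ℕ} {L : ℝ} {v : ℝ → ℝ≥0∞}

/-! ### Rigidity of near-minimisers at fixed particle number -/

/-- Pythagoras on the cell: `∫_cell (f - aΨ₀)² = ‖[f]‖² - a²` for `a = ⟪[Ψ₀], [f]⟫`, `‖[Ψ₀]‖ = 1`.
[folklore] -/
theorem lintegral_sub_mul_sq_eq {f Ψ₀ : Config M → ℝ} (hf : MemLp f 2 (volume.restrict (cellN M L)))
    (h0 : MemLp Ψ₀ 2 (volume.restrict (cellN M L))) (h1 : ‖h0.toLp Ψ₀‖ = 1) :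
    ∫⁻ X in cellN M L, ENNReal.ofReal ((f X - ⟪h0.toLp Ψ₀, hf.toLp f⟫_ℝ * Ψ₀ X) ^ 2) =
      ENNReal.ofReal (‖hf.toLp f‖ ^ 2 - ⟪h0.toLp Ψ₀, hf.toLp f⟫_ℝ ^ 2) := by
  set a : ℝ := ⟪h0.toLp Ψ₀, hf.toLp f⟫_ℝ with ha
  have hm : MemLp (f - a • Ψ₀) 2 (volume.restrict (cellN M L)) := hf.sub (h0.const_smul a)
  have e1 : (∫⁻ X in cellN M L, ENNReal.ofReal ((f X - a * Ψ₀ X) ^ 2)) =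
      ∫⁻ X in cellN M L, ENNReal.ofReal (((f - a • Ψ₀) X) ^ 2) := rfl
  rw [e1, ← ofReal_norm_toLp_sq hm, MemLp.toLp_sub hf (h0.const_smul a),
    MemLp.toLp_const_smul a h0, norm_sub_sq_real, inner_smul_right, real_inner_comm, ← ha, norm_smul,
    Real.norm_eq_abs, h1, mul_one, sq_abs]
  congr 1; ring

/-- `‖z - (a + ia') r‖² = (Re z - a r)² + (Im z - a' r)²` in `[0, ∞]` (`r` real). [folklore] -/
theorem nnnorm_sub_mk_mul_sq (z : ℂ) (a a' r : ℝ) :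
    ((‖z - (⟨a, a'⟩ : ℂ) * r‖₊ : ℝ≥0∞)) ^ 2 =
      ENNReal.ofReal ((z.re - a * r) ^ 2) + ENNReal.ofReal ((z.im - a' * r) ^ 2) := by
  rw [Dyson.nnnorm_sq_complex]
  simp [Complex.mul_re, Complex.mul_im]

/-- The elementary combination behind rigidity: `λ(1-δ) ≤ λF + M₁(1-F)`, `δ = η(λ-M₁)/λ`,
`λ > M₁`, `λ > 0` give `1 - F ≤ η`. [folklore] -/
theorem one_sub_le_of_two_level {lam M₁ F η : ℝ} (hlam : 0 < lam) (hgap : M₁ < lam)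
    (h : lam * (1 - η * (lam - M₁) / lam) ≤ lam * F + M₁ * (1 - F)) : 1 - F ≤ η := by
  have e3 : lam * (1 - η * (lam - M₁) / lam) = lam - η * (lam - M₁) := by field_simp
  rw [e3] at h
  have hgap0 : 0 < lam - M₁ := by linarith
  have e5 : (lam - M₁) * (1 - F) ≤ (lam - M₁) * η := by nlinarith
  exact le_of_mul_le_mul_left e5 hgap0
set_option maxHeartbeats 400000 in
/-- **Rigidity of near-minimisers at fixed `N` (bounded periodised potential).** Let `L > 0`, `v`
measurable with `v^per ≤ C`, and `Ψ₀` a continuous strictly positive Feynman–Kac ground state of the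
`M`-body torus Hamiltonian. For every `η > 0` there is `δ > 0` (depending on `M`, `L`, `v`: it is
`η` times the relative spectral gap of `e^{-H}`) such that every periodic trial state `Ψ` with
`𝓔^per[Ψ] ≤ E₀ + δ` is `η`-close to the ray of `Ψ₀`: with `α = ⟨Ψ₀, Ψ⟩_cell` (`|α| ≤ 1`),
`1 - η ≤ |α|²` and `‖Ψ - αΨ₀‖²_cell ≤ η`. Proof: Jensen `⟨Ψ, e^{-H}Ψ⟩ ≥ e^{-𝓔[Ψ]} ≥ e^{-E₀}(1 - δ)`
(`exp_neg_energy_le_inner_pfkL2`) against the two-level bound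
`⟨Ψ, e^{-H}Ψ⟩ ≤ e^{-E₀}|α|² + M₁(1 - |α|²)` (`norm_pfkL2_eq_and_gap`, `inner_le_two_level`).
[cite: ReedSimonIV1978, Thm XIII.44] -/
theorem rigidity_of_nearMinimiser {M : ℕ} {L : ℝ} {v : ℝ → ℝ≥0∞} (hv : Measurable v) (hL : 0 < L) {C : ℝ≥0}
    (hC : ∀ x, periodizedPotential v L x ≤ C) {Ψ₀ : Config M → ℝ}
    (hΨ : IsPeriodicGroundStateFK v L Ψ₀) (hcont : Continuous Ψ₀) (hpos : ∀ X, 0 < Ψ₀ X)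
    {η : ℝ} (hη : 0 < η) :
    ∃ δ : ℝ, 0 < δ ∧ ∀ Ψ : PeriodicTrialState M L,
      periodicEnergy v Ψ ≤ periodicGroundStateEnergy v M L + ENNReal.ofReal δ →
      ∃ α : ℂ, ‖α‖ ≤ 1 ∧ 1 - η ≤ ‖α‖ ^ 2 ∧
        ∫⁻ X in cellN M L, (‖Ψ.ψ X - α * Ψ₀ X‖₊ : ℝ≥0∞) ^ 2 ≤ ENNReal.ofReal η := by
  have h0 : MemLp Ψ₀ 2 (volume.restrict (cellN M L)) :=
    memLp_two_cellN_of_continuous_periodic hL hcont hΨ.periodic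
  obtain ⟨-, M₁, hM₁, hM₁0, hgap⟩ := norm_pfkL2_eq_and_gap hv hL hC hΨ hpos h0
  have hlam0 : 0 < Real.exp (-(periodicGroundStateEnergy v M L).toReal) := Real.exp_pos _
  have hgap0 : 0 < Real.exp (-(periodicGroundStateEnergy v M L).toReal) - M₁ := by linarith
  obtain ⟨δ, hδ⟩ : ∃ δ : ℝ, δ = η * (Real.exp (-(periodicGroundStateEnergy v M L).toReal) - M₁) /
    Real.exp (-(periodicGroundStateEnergy v M L).toReal) := ⟨_, rfl⟩
  have hδ0 : 0 < δ := by rw [hδ]; positivity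
  refine ⟨δ, hδ0, fun Ψ hΨE => ?_⟩
  -- the energy of `Ψ` is finite and within `δ` of `E₀`
  have hE₀top : periodicGroundStateEnergy v M L ≠ ⊤ := hΨ.energy_ne_top
  have hsumtop : periodicGroundStateEnergy v M L + ENNReal.ofReal δ ≠ ⊤ :=
    ENNReal.add_ne_top.2 ⟨hE₀top, ENNReal.ofReal_ne_top⟩
  have hEtop : periodicEnergy v Ψ ≠ ⊤ := ne_top_of_le_ne_top hsumtop hΨE
  have hEreal : (periodicEnergy v Ψ).toReal ≤ (periodicGroundStateEnergy v M L).toReal + δ := by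
    have := ENNReal.toReal_mono hsumtop hΨE
    rwa [ENNReal.toReal_add hE₀top ENNReal.ofReal_ne_top, ENNReal.toReal_ofReal hδ0.le] at this
  -- real and imaginary parts
  set f : Config M → ℝ := fun Y => (Ψ.ψ Y).re with hf
  set g : Config M → ℝ := fun Y => (Ψ.ψ Y).im with hg
  have hfC : ContDiff ℝ 1 f := Complex.reCLM.contDiff.comp Ψ.contDiff
  have hgC : ContDiff ℝ 1 g := Complex.imCLM.contDiff.comp Ψ.contDiff
  have hfper : ∀ (X : Config M) (i : Fin M) (k : Fin 3),
      f (X + Pi.single i (EuclideanSpace.single k L)) = f X := fun X i k => by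
    simp only [hf, Ψ.periodic X i k]
  have hgper : ∀ (X : Config M) (i : Fin M) (k : Fin 3),
      g (X + Pi.single i (EuclideanSpace.single k L)) = g X := fun X i k => by
    simp only [hg, Ψ.periodic X i k]
  have hfm : MemLp f 2 (volume.restrict (cellN M L)) :=
    memLp_two_cellN_of_continuous_periodic hL hfC.continuous hfper
  have hgm : MemLp g 2 (volume.restrict (cellN M L)) :=
    memLp_two_cellN_of_continuous_periodic hL hgC.continuous hgper
  -- the energy splits into four finite pieces
  set Kf := ∫⁻ X in cellN M L, realKinetic f X with hKf
  set Pf := ∫⁻ X in cellN M L, ENNReal.ofReal (f X ^ 2) * periodicInteraction v L X with hPf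
  set Kg := ∫⁻ X in cellN M L, realKinetic g X with hKg
  set Pg := ∫⁻ X in cellN M L, ENNReal.ofReal (g X ^ 2) * periodicInteraction v L X with hPg
  have hEeq : periodicEnergy v Ψ = (Kf + Pf) + (Kg + Pg) := periodicEnergy_eq_re_add_im hv Ψ
  have hfin : (Kf + Pf) + (Kg + Pg) ≠ ⊤ := hEeq ▸ hEtop
  have hKf' : Kf ≠ ⊤ := fun h => hfin (by rw [h, top_add, top_add])
  have hPf' : Pf ≠ ⊤ := fun h => hfin (by rw [h, add_top, top_add])
  have hKg' : Kg ≠ ⊤ := fun h => hfin (by rw [h, top_add, add_top])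
  have hPg' : Pg ≠ ⊤ := fun h => hfin (by rw [h, add_top, add_top])
  have hEtoReal : (periodicEnergy v Ψ).toReal = (Kf.toReal + Pf.toReal) + (Kg.toReal + Pg.toReal) := by
    rw [hEeq, ENNReal.toReal_add (ENNReal.add_ne_top.2 ⟨hKf', hPf'⟩) (ENNReal.add_ne_top.2 ⟨hKg', hPg'⟩),
      ENNReal.toReal_add hKf' hPf', ENNReal.toReal_add hKg' hPg']
  -- unit mass
  have hnorm : ‖hfm.toLp f‖ ^ 2 + ‖hgm.toLp g‖ ^ 2 = 1 := by
    have h := setLIntegral_cellN_re_sq_add_im_sq Ψ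
    rw [← ofReal_norm_toLp_sq hfm, ← ofReal_norm_toLp_sq hgm,
      ← ENNReal.ofReal_add (sq_nonneg _) (sq_nonneg _)] at h
    have := congrArg ENNReal.toReal h
    rwa [ENNReal.toReal_ofReal (by positivity), ENNReal.toReal_one] at this
  -- Jensen from below
  have hlow := exp_neg_energy_le_inner_pfkL2 hv hL hC hfC hgC hfper hgper hfm hgm hnorm hKf' hPf' hKg' hPg'
  rw [← hEtoReal] at hlow
  -- the two-level bound from above
  have hsym : ∀ x y : Lp ℝ 2 (volume.restrict (cellN M L)),
      ⟪pfkL2 v L 1 x, y⟫_ℝ = ⟪x, pfkL2 v L 1 y⟫_ℝ := fun x y => inner_pfkL2_comm hv hL one_pos x y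
  have hTx₀ : pfkL2 v L 1 (h0.toLp Ψ₀) =
      Real.exp (-(periodicGroundStateEnergy v M L).toReal) • h0.toLp Ψ₀ := by
    have h := pfkL2_toLp_groundState hv hL one_pos hΨ h0
    rwa [mul_one] at h
  have hx₀1 : ‖h0.toLp Ψ₀‖ = 1 := norm_toLp_groundState hΨ h0
  have hupf := inner_le_two_level (pfkL2 v L 1) hsym hx₀1 hTx₀ hgap (hfm.toLp f)
  have hupg := inner_le_two_level (pfkL2 v L 1) hsym hx₀1 hTx₀ hgap (hgm.toLp g)
  have haf : ⟪h0.toLp Ψ₀, hfm.toLp f⟫_ℝ ^ 2 ≤ ‖hfm.toLp f‖ ^ 2 := by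
    have h := abs_real_inner_le_norm (h0.toLp Ψ₀) (hfm.toLp f)
    rw [hx₀1, one_mul] at h
    rw [← sq_abs]
    exact pow_le_pow_left₀ (abs_nonneg _) h 2
  have hag : ⟪h0.toLp Ψ₀, hgm.toLp g⟫_ℝ ^ 2 ≤ ‖hgm.toLp g‖ ^ 2 := by
    have h := abs_real_inner_le_norm (h0.toLp Ψ₀) (hgm.toLp g)
    rw [hx₀1, one_mul] at h
    rw [← sq_abs]
    exact pow_le_pow_left₀ (abs_nonneg _) h 2
  generalize ha : ⟪h0.toLp Ψ₀, hfm.toLp f⟫_ℝ = a at hupf haf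
  generalize ha' : ⟪h0.toLp Ψ₀, hgm.toLp g⟫_ℝ = a' at hupg hag
  have hF1 : a ^ 2 + a' ^ 2 ≤ 1 := by linarith
  -- combine
  have hkey : 1 - (a ^ 2 + a' ^ 2) ≤ η := by
    refine one_sub_le_of_two_level hlam0 hM₁ ?_
    rw [← hδ]
    have e1 : Real.exp (-(periodicGroundStateEnergy v M L).toReal) * Real.exp (-δ) ≤
        Real.exp (-(periodicEnergy v Ψ).toReal) := by
      rw [← Real.exp_add]
      exact Real.exp_le_exp.2 (by linarith)
    have e2 : 1 - δ ≤ Real.exp (-δ) := by linarith [Real.add_one_le_exp (-δ)]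
    calc Real.exp (-(periodicGroundStateEnergy v M L).toReal) * (1 - δ)
        ≤ Real.exp (-(periodicGroundStateEnergy v M L).toReal) * Real.exp (-δ) :=
          mul_le_mul_of_nonneg_left e2 hlam0.le
      _ ≤ _ := e1.trans (hlow.trans (by nlinarith [hupf, hupg, hnorm]))
  refine ⟨⟨a, a'⟩, ?_, ?_, ?_⟩
  · rw [← sq_le_one_iff₀ (norm_nonneg _), Complex.sq_norm, Complex.normSq_mk]
    nlinarith only [hF1]
  · rw [Complex.sq_norm, Complex.normSq_mk]
    nlinarith only [hkey]
  · have hΨm : Measurable Ψ₀ := hΨ.measurable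
    have hfmeas : Measurable f := hfC.continuous.measurable
    have hpt : ∀ X, (‖Ψ.ψ X - (⟨a, a'⟩ : ℂ) * Ψ₀ X‖₊ : ℝ≥0∞) ^ 2 =
        ENNReal.ofReal ((f X - a * Ψ₀ X) ^ 2) + ENNReal.ofReal ((g X - a' * Ψ₀ X) ^ 2) :=
      fun X => nnnorm_sub_mk_mul_sq (Ψ.ψ X) a a' (Ψ₀ X)
    have hmeas : Measurable fun X => ENNReal.ofReal ((f X - a * Ψ₀ X) ^ 2) :=
      ENNReal.measurable_ofReal.comp ((hfmeas.sub (measurable_const.mul hΨm)).pow_const 2)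
    simp_rw [hpt]
    rw [lintegral_add_left hmeas, ← ha, ← ha', lintegral_sub_mul_sq_eq hfm h0 hx₀1,
      lintegral_sub_mul_sq_eq hgm h0 hx₀1, ha, ha', ← ENNReal.ofReal_add (by linarith) (by linarith)]
    exact ENNReal.ofReal_le_ofReal (by linarith)

/-! ### The insertion overlap `ov(F, G) = ∫_{cell^N} conj F(X) ∫_cell G(x, X)`: Cauchy–Schwarz and bilinearity -/

/-- **Cauchy–Schwarz for the insertion overlap**:
`L⁻³ |∫_{cell^N} conj F(X) ∫_cell G(x,X) dx dX|² ≤ ‖F‖²_{cell^N} ‖G‖²_{cell^{N+1}}` (Cauchy–Schwarz in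
`X`, then in `x` slice by slice, then Tonelli). [folklore] -/
theorem overlap_sq_le (hL : 0 < L) {F : Config N → ℂ} {G : Config (N + 1) → ℂ}
    (hF : Measurable F) (hG : Measurable G) :
    ENNReal.ofReal ((L ^ 3)⁻¹) *
      (‖∫ X in cellN N L, conj (F X) * ∫ x in cell L, G (vecCons x X)‖₊ : ℝ≥0∞) ^ 2 ≤
      (∫⁻ X in cellN N L, (‖F X‖₊ : ℝ≥0∞) ^ 2) * ∫⁻ X in cellN (N + 1) L, (‖G X‖₊ : ℝ≥0∞) ^ 2 := by
  set g : Config N → ℂ := fun X => ∫ x in cell L, G (vecCons x X) with hg_def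
  have hg : Measurable g := measurable_setIntegral_vecCons hG _
  have hCS := sq_nnnorm_integral_mul_conj_le (ν := volume.restrict (cellN N L)) (f := g)
    (g := F) hg.aemeasurable hF.aemeasurable
  have hcomm : (∫ X in cellN N L, conj (F X) * g X) = ∫ X in cellN N L, g X * conj (F X) := by
    congr 1; funext X; ring
  have hGn : Measurable fun X => (‖G X‖₊ : ℝ≥0∞) ^ 2 := (hG.nnnorm.coe_nnreal_ennreal).pow_const _
  have hL3 : ENNReal.ofReal L ^ 3 ≠ 0 := pow_ne_zero _ (ENNReal.ofReal_pos.2 hL).ne'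
  have hL3' : ENNReal.ofReal L ^ 3 ≠ ⊤ := ENNReal.pow_ne_top ENNReal.ofReal_ne_top
  have hslice : ∀ Y : Config N, (‖g Y‖₊ : ℝ≥0∞) ^ 2 ≤
      ENNReal.ofReal L ^ 3 * ∫⁻ x in cell L, (‖G (vecCons x Y)‖₊ : ℝ≥0∞) ^ 2 := by
    intro Y
    have h := sq_nnnorm_integral_mul_conj_le (ν := volume.restrict (cell L))
      (f := fun x => G (vecCons x Y)) (g := fun _ => (1 : ℂ))
      (measurable_comp_vecCons_left hG Y).aemeasurable aemeasurable_const
    simp only [map_one, mul_one, nnnorm_one, ENNReal.coe_one, one_pow, lintegral_const,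
      Measure.restrict_apply_univ, volume_cell, one_mul] at h
    exact h.trans_eq (mul_comm _ _)
  have hgl : ∫⁻ Y in cellN N L, (‖g Y‖₊ : ℝ≥0∞) ^ 2 ≤
      ENNReal.ofReal L ^ 3 * ∫⁻ X in cellN (N + 1) L, (‖G X‖₊ : ℝ≥0∞) ^ 2 := by
    calc ∫⁻ Y in cellN N L, (‖g Y‖₊ : ℝ≥0∞) ^ 2
        ≤ ∫⁻ Y in cellN N L, ENNReal.ofReal L ^ 3 * ∫⁻ x in cell L, (‖G (vecCons x Y)‖₊ : ℝ≥0∞) ^ 2 :=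
          lintegral_mono hslice
      _ = _ := by rw [lintegral_const_mul' _ _ hL3', setLIntegral_cellN_succ_right hGn]
  have hL3eq : ENNReal.ofReal ((L ^ 3)⁻¹) = (ENNReal.ofReal L ^ 3)⁻¹ := by
    rw [ENNReal.ofReal_inv_of_pos (by positivity), ENNReal.ofReal_pow hL.le]
  rw [hcomm, hL3eq]
  calc (ENNReal.ofReal L ^ 3)⁻¹ * (‖∫ X in cellN N L, g X * conj (F X)‖₊ : ℝ≥0∞) ^ 2
      ≤ (ENNReal.ofReal L ^ 3)⁻¹ * ((∫⁻ Y in cellN N L, (‖g Y‖₊ : ℝ≥0∞) ^ 2) *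
          ∫⁻ X in cellN N L, (‖F X‖₊ : ℝ≥0∞) ^ 2) := mul_le_mul_right hCS _
    _ ≤ (ENNReal.ofReal L ^ 3)⁻¹ * ((ENNReal.ofReal L ^ 3 *
          ∫⁻ X in cellN (N + 1) L, (‖G X‖₊ : ℝ≥0∞) ^ 2) * ∫⁻ X in cellN N L, (‖F X‖₊ : ℝ≥0∞) ^ 2) := by
        gcongr
    _ = _ := by
        rw [← mul_assoc, ← mul_assoc, ENNReal.inv_mul_cancel hL3 hL3', one_mul, mul_comm]

/-- `(‖z‖₊ : ℝ≥0∞)².toReal = ‖z‖²`. [folklore] -/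
theorem toReal_coe_nnnorm_sq (z : ℂ) : (((‖z‖₊ : ℝ≥0∞)) ^ 2).toReal = ‖z‖ ^ 2 := by
  rw [ENNReal.toReal_pow, ENNReal.coe_toReal, coe_nnnorm]

/-- **The overlap is `L²`-bounded**, real form: `|ov(F, G)| ≤ √(L³) ‖F‖_{cell^N} ‖G‖_{cell^{N+1}}` for
measurable `F, G` of finite cell mass. [folklore] -/
theorem norm_overlap_le (hL : 0 < L) {F : Config N → ℂ} {G : Config (N + 1) → ℂ}
    (hF : Measurable F) (hG : Measurable G) (hF2 : ∫⁻ X in cellN N L, (‖F X‖₊ : ℝ≥0∞) ^ 2 ≠ ⊤)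
    (hG2 : ∫⁻ X in cellN (N + 1) L, (‖G X‖₊ : ℝ≥0∞) ^ 2 ≠ ⊤) :
    ‖∫ X in cellN N L, conj (F X) * ∫ x in cell L, G (vecCons x X)‖ ≤
      Real.sqrt (L ^ 3) * Real.sqrt ((∫⁻ X in cellN N L, (‖F X‖₊ : ℝ≥0∞) ^ 2).toReal) *
        Real.sqrt ((∫⁻ X in cellN (N + 1) L, (‖G X‖₊ : ℝ≥0∞) ^ 2).toReal) := by
  have h := overlap_sq_le hL hF hG
  have hfin : (∫⁻ X in cellN N L, (‖F X‖₊ : ℝ≥0∞) ^ 2) * ∫⁻ X in cellN (N + 1) L, (‖G X‖₊ : ℝ≥0∞) ^ 2 ≠ ⊤ :=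
    ENNReal.mul_ne_top hF2 hG2
  have h' := ENNReal.toReal_mono hfin h
  rw [ENNReal.toReal_mul, ENNReal.toReal_mul, ENNReal.toReal_ofReal (by positivity),
    toReal_coe_nnnorm_sq] at h'
  set a := (∫⁻ X in cellN N L, (‖F X‖₊ : ℝ≥0∞) ^ 2).toReal with ha
  set b := (∫⁻ X in cellN (N + 1) L, (‖G X‖₊ : ℝ≥0∞) ^ 2).toReal with hb
  have ha0 : 0 ≤ a := ENNReal.toReal_nonneg
  have hb0 : 0 ≤ b := ENNReal.toReal_nonneg
  have hL3 : 0 < L ^ 3 := by positivity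
  rw [← Real.sqrt_mul hL3.le, ← Real.sqrt_mul (by positivity)]
  refine (Real.le_sqrt (norm_nonneg _) (by positivity)).2 ?_
  rw [inv_mul_le_iff₀ hL3] at h'
  linarith

/-- A bounded measurable integrand of overlap type is integrable on the cell. [folklore] -/
theorem integrable_conj_mul_setIntegral (L : ℝ) {F : Config N → ℂ} {G : Config (N + 1) → ℂ}
    (hF : Measurable F) (hG : Measurable G) {B₁ B₂ : ℝ} (hFb : ∀ X, ‖F X‖ ≤ B₁)
    (hGb : ∀ X, ‖G X‖ ≤ B₂) :
    Integrable (fun X => conj (F X) * ∫ x in cell L, G (vecCons x X)) (volume.restrict (cellN N L)) := by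
  have hvol : volume (cell L) < ⊤ := by rw [volume_cell]; exact ENNReal.pow_lt_top ENNReal.ofReal_lt_top
  have hI : ∀ X, ‖∫ x in cell L, G (vecCons x X)‖ ≤ B₂ * (volume.real (cell L)) := fun X =>
    norm_setIntegral_le_of_norm_le_const hvol fun x _ => hGb _
  have hm : Measurable fun X => conj (F X) * ∫ x in cell L, G (vecCons x X) :=
    (Complex.continuous_conj.measurable.comp hF).mul (measurable_setIntegral_vecCons hG _)
  refine Measure.integrableOn_of_bounded (volume_cellN_ne_top N L) hm.aestronglyMeasurable
    (M := B₁ * (B₂ * volume.real (cell L))) (Eventually.of_forall fun X => ?_)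
  rw [norm_mul, RCLike.norm_conj]
  exact mul_le_mul (hFb X) (hI X) (norm_nonneg _) ((norm_nonneg _).trans (hFb X))

/-- **Bilinearity of the overlap**: `ov(F, G) - ov(F', G') = ov(F - F', G) + ov(F', G - G')` for bounded
measurable `F, F', G, G'`. [folklore] -/
theorem overlap_sub_overlap (L : ℝ) {F F' : Config N → ℂ} {G G' : Config (N + 1) → ℂ}
    (hF : Measurable F) (hF' : Measurable F') (hG : Measurable G) (hG' : Measurable G')
    (hFb : ∃ B, ∀ X, ‖F X‖ ≤ B) (hF'b : ∃ B, ∀ X, ‖F' X‖ ≤ B) (hGb : ∃ B, ∀ X, ‖G X‖ ≤ B)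
    (hG'b : ∃ B, ∀ X, ‖G' X‖ ≤ B) :
    (∫ X in cellN N L, conj (F X) * ∫ x in cell L, G (vecCons x X)) -
        ∫ X in cellN N L, conj (F' X) * ∫ x in cell L, G' (vecCons x X) =
      (∫ X in cellN N L, conj (F X - F' X) * ∫ x in cell L, G (vecCons x X)) +
        ∫ X in cellN N L, conj (F' X) * ∫ x in cell L, (G (vecCons x X) - G' (vecCons x X)) := by
  obtain ⟨B₁, hB₁⟩ := hFb
  obtain ⟨B₂, hB₂⟩ := hF'b
  obtain ⟨B₃, hB₃⟩ := hGb
  obtain ⟨B₄, hB₄⟩ := hG'b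
  have hvol : volume (cell L) ≠ ⊤ := by
    rw [volume_cell]; exact (ENNReal.pow_lt_top ENNReal.ofReal_lt_top).ne
  -- the inner integrals are additive
  have hinner : ∀ X : Config N, (∫ x in cell L, (G (vecCons x X) - G' (vecCons x X))) =
      (∫ x in cell L, G (vecCons x X)) - ∫ x in cell L, G' (vecCons x X) := by
    intro X
    refine integral_sub ?_ ?_
    · exact Measure.integrableOn_of_bounded hvol (measurable_comp_vecCons_left hG X).aestronglyMeasurable
        (Eventually.of_forall fun x => hB₃ _)
    · exact Measure.integrableOn_of_bounded hvol (measurable_comp_vecCons_left hG' X).aestronglyMeasurable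
        (Eventually.of_forall fun x => hB₄ _)
  -- integrability of the four outer integrands
  have i1 := integrable_conj_mul_setIntegral L hF hG hB₁ hB₃
  have i2 := integrable_conj_mul_setIntegral L hF' hG' hB₂ hB₄
  have hFF' : Measurable fun X => F X - F' X := hF.sub hF'
  have hGG' : Measurable fun Z => G Z - G' Z := hG.sub hG'
  have i3 := integrable_conj_mul_setIntegral L (G := G) hFF' hG (B₁ := B₁ + B₂)
    (fun X => (norm_sub_le _ _).trans (add_le_add (hB₁ X) (hB₂ X))) hB₃
  have i4 := integrable_conj_mul_setIntegral L (F := F') (G := fun Z => G Z - G' Z) hF' hGG' hB₂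
    (B₂ := B₃ + B₄) (fun Z => (norm_sub_le _ _).trans (add_le_add (hB₃ Z) (hB₄ Z)))
  rw [← integral_sub i1 i2, ← integral_add i3 i4]
  refine integral_congr_ae (Eventually.of_forall fun X => ?_)
  simp only [hinner X, map_sub]
  ring

end Summit.AtomisticToContinuum.BoseEinsteinCondensation.Theorems.CorrectorClosure.HealingScaleKacInsertion

end
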